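import Summits.ResolutionOfSingularities.ResolutionOfSingularities.Theorems.UniversalCellsDefs

/-!
# Route UniversalCells — crux `Universality` (stmt-ResolutionOfSingularities-15234), line `birth`
## Stub `stub_chartGlobalisation`

CHART GLOBALISATION — the last, purely scheme-theoretic move of the crux proof (Lee–Vakil 2012,
§2 Strategy (b): "`X` is an open subscheme of `Y × 𝔸ˢ`"). The algebraic stubs of the line deliver,
at an affine open `U ∋ y` of the integral scheme `Y` with `e : Γ(Y, U) ≃+* B`, a polynomial
`g ∈ B[t₁, …, tₛ]` not lying in `𝔭 B[t]` (`𝔭 ⊂ B` the prime of `y`) and a ring isomorphism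
`B[t][1/g] ≃+* S[1/h]` with the partial stratum ring `S = StratumRing p m Γ₊ Γ₀`. From these we
build

* `W := Spec B[t][1/g]`, integral because `B ≅ Γ(Y, U)` is a domain (`U ≠ ∅`, `Y` integral),
  hence so are `B[t]` and its localisation away from `g ≠ 0`;
* the open immersion `j : W ⟶ 𝔸ˢ_Y`, the composite of `Spec B[t][1/g] ⟶ Spec B[t]` (a basic
  open), `Spec B[t] ≅ 𝔸ˢ_{Spec B}` (`AffineSpace.SpecIso`) and `𝔸ˢ_{Spec B} ⟶ 𝔸ˢ_Y`, the base
  change (`AffineSpace.isPullback_map`) of the open immersion `Spec B ≅ Spec Γ(Y, U) ≅ U ⊆ Y`;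
* the open immersion `i : W ≅ Spec S[1/h] ⟶ Spec S`;
* a point `w ∈ W` over `y`: some coefficient of `g` does not vanish at `𝔭`, so `𝔭` lies in the
  image of the basic open `D(g) ⊆ Spec B[t]` (`MvPolynomial.mem_image_comap_C_basicOpen`), which is
  the image of `Spec B[t][1/g]` (`PrimeSpectrum.localization_away_comap_range`); the structure map
  `𝔸ˢ_Y ⟶ Y` is traced with `AffineSpace.map_over`, `AffineSpace.SpecIso_inv_over` and
  `IsAffineOpen.fromSpec_primeIdealOf`.
-/

-- single-problem summit: the doubled namespace component `ResolutionOfSingularities` is forced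
set_option linter.dupNamespace false

noncomputable section

open CategoryTheory AlgebraicGeometry

namespace Summit.ResolutionOfSingularities.ResolutionOfSingularities.Theorems.UniversalCells

namespace ChartGlobalisation

/-- The base change `𝔸ⁿ_S ⟶ 𝔸ⁿ_T` of an open immersion `S ⟶ T` is an open immersion.
[cite: StacksProject, Tag 01JJ] -/
theorem isOpenImmersion_affineSpaceMap (n : Type) {S T : Scheme.{0}} (f : S ⟶ T)
    [IsOpenImmersion f] : IsOpenImmersion (AffineSpace.map n f) :=
  MorphismProperty.of_isPullback (P := @IsOpenImmersion)
    (AffineSpace.isPullback_map f).flip ‹_›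

/-- The chart morphism `Spec R[t][1/g] ⟶ Spec R[t] ≅ 𝔸ⁿ_{Spec R} ⟶ 𝔸ⁿ_T` attached to an open
immersion `Spec R ⟶ T` is an open immersion. [cite: StacksProject, Tag 01IZ] -/
theorem isOpenImmersion_chart (n : Type) (R : CommRingCat.{0}) {T : Scheme.{0}}
    (f : Spec R ⟶ T) [IsOpenImmersion f] (g : MvPolynomial n R) :
    IsOpenImmersion (Spec.map (CommRingCat.ofHom
        (algebraMap (MvPolynomial n R) (Localization.Away g))) ≫
      (AffineSpace.SpecIso n R).inv ≫ AffineSpace.map n f) := by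
  haveI := isOpenImmersion_affineSpaceMap n f
  haveI : IsOpenImmersion (Spec.map (CommRingCat.ofHom
      (algebraMap (MvPolynomial n R) (Localization.Away g)))) :=
    IsOpenImmersion.of_isLocalization g
  infer_instance

/-- The chart morphism followed by the structure map `𝔸ⁿ_T ⟶ T` is
`Spec R[t][1/g] ⟶ Spec R[t] ⟶ Spec R ⟶ T`. [folklore] -/
theorem chart_over (n : Type) (R : CommRingCat.{0}) {T : Scheme.{0}}
    (f : Spec R ⟶ T) (g : MvPolynomial n R) :
    (Spec.map (CommRingCat.ofHom (algebraMap (MvPolynomial n R) (Localization.Away g))) ≫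
      (AffineSpace.SpecIso n R).inv ≫ AffineSpace.map n f) ≫ 𝔸(n; T) ↘ T =
    Spec.map (CommRingCat.ofHom (algebraMap (MvPolynomial n R) (Localization.Away g))) ≫
      Spec.map (CommRingCat.ofHom MvPolynomial.C) ≫ f := by
  simp only [Category.assoc, AffineSpace.map_over, AffineSpace.SpecIso_inv_over_assoc]

/-- On points, the chart morphism followed by the structure map `𝔸ⁿ_T ⟶ T` is
`f ∘ Spec(C) ∘ Spec(R[t] → R[t][1/g])`. [folklore] -/
theorem chart_over_apply (n : Type) (R : CommRingCat.{0}) {T : Scheme.{0}}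
    (f : Spec R ⟶ T) (g : MvPolynomial n R) (w : Spec (.of (Localization.Away g))) :
    (𝔸(n; T) ↘ T).base ((Spec.map (CommRingCat.ofHom
        (algebraMap (MvPolynomial n R) (Localization.Away g))) ≫
      (AffineSpace.SpecIso n R).inv ≫ AffineSpace.map n f).base w) =
    f.base (PrimeSpectrum.comap (MvPolynomial.C : R →+* MvPolynomial n R)
      (PrimeSpectrum.comap (algebraMap (MvPolynomial n R) (Localization.Away g)) w)) := by
  have H := congrArg (fun k : Spec (.of (Localization.Away g)) ⟶ T => k.base w)
    (chart_over n R f g)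
  simpa only [Scheme.Hom.comp_base, TopCat.comp_app, Spec.map_apply, CommRingCat.hom_ofHom]
    using H

/-- Globalisation of a ring-level chart along an open immersion `f : Spec R ⟶ Y` (with `R` a
domain): `W := Spec R[t][1/g]` is integral, open in `𝔸ˢ_Y` and in `Spec S`, and has a point over
`f x` as soon as some coefficient of `g` does not vanish at `x`.
[cite: LeeVakil2012, §2 Strategy (b); StacksProject, Tag 01JJ] -/
theorem exists_chart (R : CommRingCat.{0}) [IsDomain R] {Y : Scheme.{0}}
    (f : Spec R ⟶ Y) [IsOpenImmersion f] (x : PrimeSpectrum R) (s : ℕ)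
    (g : MvPolynomial (Fin s) R) (hg : ∃ i, g.coeff i ∉ x.asIdeal)
    (S : Type) [CommRing S] (h : S) (echart : Localization.Away g ≃+* Localization.Away h) :
    ∃ (W : Scheme.{0}) (j : W ⟶ 𝔸(Fin s; Y)) (w : W) (i : W ⟶ Spec (.of S)),
      IsOpenImmersion j ∧ IsOpenImmersion i ∧ IsIntegral W ∧
        (𝔸(Fin s; Y) ↘ Y).base (j.base w) = f.base x := by
  classical
  obtain ⟨P, hP, hPx⟩ := (MvPolynomial.mem_image_comap_C_basicOpen g x).mpr hg
  obtain ⟨w, hw⟩ : P ∈ Set.range (PrimeSpectrum.comap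
      (algebraMap (MvPolynomial (Fin s) R) (Localization.Away g))) := by
    rw [PrimeSpectrum.localization_away_comap_range (Localization.Away g) g]
    exact hP
  have hg0 : g ≠ 0 := by
    rintro rfl
    obtain ⟨i, hi⟩ := hg
    exact hi (by simp)
  haveI : IsDomain (Localization.Away g) :=
    IsLocalization.Away.isDomain (Localization.Away g) hg0
  haveI : IsOpenImmersion
      (Spec.map (CommRingCat.ofHom (algebraMap S (Localization.Away h)))) :=
    IsOpenImmersion.of_isLocalization h
  refine ⟨Spec (.of (Localization.Away g)),
    Spec.map (CommRingCat.ofHom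
        (algebraMap (MvPolynomial (Fin s) R) (Localization.Away g))) ≫
      (AffineSpace.SpecIso (Fin s) R).inv ≫ AffineSpace.map (Fin s) f,
    w,
    Spec.map echart.toCommRingCatIso.inv ≫
      Spec.map (CommRingCat.ofHom (algebraMap S (Localization.Away h))),
    isOpenImmersion_chart (Fin s) R f g, inferInstance, inferInstance, ?_⟩
  rw [chart_over_apply, hw, hPx]

end ChartGlobalisation

open ChartGlobalisation in
/-- **CHART GLOBALISATION.** Ring-level chart data at an affine open `U ∋ y` of an integral
scheme `Y` — an identification `e : Γ(Y, U) ≃+* B`, a polynomial `g ∈ B[t₁, …, tₛ]` with a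
coefficient not vanishing at `y`, and a ring isomorphism `B[t][1/g] ≃+* S[1/h]` with the stratum
ring `S` — globalise to the open immersions `W := Spec B[t][1/g] ⟶ 𝔸ˢ_Y` (through
`𝔸ˢ_{Spec B} ≅ 𝔸ˢ_U ⊆ 𝔸ˢ_Y`) and `W ⟶ Spec S` (through `Spec S[1/h]`), with `W` integral and a
point of `W` over `y`. [cite: LeeVakil2012, §2 Strategy (b); StacksProject, Tag 01IZ, Tag 01JJ] -/
theorem stub_chartGlobalisation (p : ℕ) (Y : Scheme.{0}) (hY : IsIntegral Y) (y : Y)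
    (U : Y.Opens) (hU : IsAffineOpen U) (hy : y ∈ U) (B : Type) [CommRing B]
    (e : Γ(Y, U) ≃+* B) (m : ℕ) (Γp : Finset (Fin 3 → Fin 3 ⊕ Fin m))
    (Γ0 : Set (Fin 3 → Fin 3 ⊕ Fin m)) (s : ℕ) (g : MvPolynomial (Fin s) B)
    (h : StratumRing p m Γp Γ0)
    (hg : g ∉ Ideal.map (MvPolynomial.C : B →+* _) (Ideal.map e (hU.primeIdealOf ⟨y, hy⟩).asIdeal))
    (echart : Localization.Away g ≃+* Localization.Away h) :
    ∃ (W : Scheme.{0}) (j : W ⟶ 𝔸(Fin s; Y)) (w : W)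
      (i : W ⟶ Spec (.of (StratumRing p m Γp Γ0))),
      IsOpenImmersion j ∧ IsOpenImmersion i ∧ IsIntegral W ∧
        (CategoryTheory.over (𝔸(Fin s; Y)) Y).base (j.base w) = y := by
  haveI := hY
  haveI : Nonempty U := ⟨⟨y, hy⟩⟩
  haveI : IsDomain B := MulEquiv.isDomain Γ(Y, U) e.symm.toMulEquiv
  -- the prime of `B` corresponding to `y`
  let x : PrimeSpectrum B := ⟨Ideal.map e (hU.primeIdealOf ⟨y, hy⟩).asIdeal, inferInstance⟩
  have hcoeff : ∃ i, g.coeff i ∉ x.asIdeal := by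
    by_contra hcon
    push Not at hcon
    exact hg (MvPolynomial.mem_map_C_iff.mpr hcon)
  -- the open immersion `Spec B ≅ Spec Γ(Y, U) ≅ U ⊆ Y`
  obtain ⟨W, j, w, i, hj, hi, hW, hw⟩ := exists_chart (.of B)
    (Spec.map e.toCommRingCatIso.hom ≫ hU.fromSpec) x s g hcoeff (StratumRing p m Γp Γ0) h
    echart
  refine ⟨W, j, w, i, hj, hi, hW, hw.trans ?_⟩
  have hx : (Spec.map e.toCommRingCatIso.hom).base x = hU.primeIdealOf ⟨y, hy⟩ := by
    apply PrimeSpectrum.ext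
    exact Ideal.comap_map_of_bijective e e.bijective
  rw [Scheme.Hom.comp_base, TopCat.comp_app, hx]
  exact hU.fromSpec_primeIdealOf ⟨y, hy⟩

end Summit.ResolutionOfSingularities.ResolutionOfSingularities.Theorems.UniversalCells

end
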